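import Literature.MathematicalPhysics.QuantumFieldTheory.Balaban1983to89.TraceWordsSeparateOrbitsEvenOrthogonal
import HarnessLib

/-!
# CENSUS NEGATIVE on `ℤ^d`: the products of natural-representation Wilson loops do NOT span the gauge-invariant cylinder
# observables of `SO(2m)` lattice gauge theory, `m ≥ 1`, `d ≥ 2` — `¬ SpansGaugeInvariantCylinders` for
# `specialOrthogonalRep (Fin 2m)` (the Pfaffian of the skew projection of one plaquette holonomy is a gauge-invariant local
# observable odd under conjugation by a reflection, to which every Wilson loop is blind; [AslaksenTanZhu1995] §1, Thm 3)

statement-level skeleton of published theorems with citation tags; proofs where landed; nothing here is a claim about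
the Yang–Mills mass gap

Module XIX (`InfiniteVolumeSufficientXIX`) typed Lévy's density theorem as the schema `SpansGaugeInvariantCylinders d 𝒲`
and proved `(3a) ⟺ (W-corr)` UNDER it for `𝒲 = wilsonLoopProducts ρ d`; module XX proved the schema for trace-separating
`ρ` and REFUTED it for the rotation representation `so2Rep` of `U(1) ≅ SO(2)` (`not_spansGaugeInvariantCylinders_so2Rep`:
the global inversion `U ↦ U⁻¹` is invisible to those Wilson loops).  `TraceWordsSeparateOrbitsEvenOrthogonal` refuted the
group-theoretic schemas `TraceWordsSeparateOrbits` / `TraceWordsDense` for the natural representation of EVERY `SO(2m)`,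
`m ≥ 1`, with the Pfaffian of the skew projection `p̃f(X) = pf(X − Xᵀ)` ([AslaksenTanZhu1995] §1 p.207: «This is clearly
an SO(2k, F) invariant», changing sign under the reflections of `O(2m) ∖ SO(2m)`).  This file carries the refutation to
the LATTICE, exactly in the pattern of module XX's `U(1)` negative:

* §1 `reflConj m i₀ : SO(2m) →* SO(2m)`, `g ↦ P g P`, conjugation by the reflection `P = diag(…, −1, …)` (an automorphism
  of `SO(2m)` coming from `O(2m)`); the natural-representation character is blind to it (`tracePart_reflConj`).
* §2 holonomies of a pointwise-transformed configuration `φ ∘ U` (`φ` a group homomorphism) are `φ` of the holonomies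
  (`walkHolonomy_monoidHom`, `plaquetteHolonomyZd_monoidHom`); hence EVERY element of the span of the Wilson-loop products of
  `specialOrthogonalRep (Fin 2m)` takes the same value at `U` and at `P U P` (`mem_span_wilsonLoopProducts_reflConj`).
* §3 the gauge-invariant, continuous, bounded CYLINDER observable `pfPlaquette m d (U) = p̃f(U_p)`, `p` the plaquette at the
  origin in the `(0,1)` plane of `ℤ^{d+2}`; the test configuration `J` on one edge (`testConfigJ`) has `pfPlaquette = c ≠ 0`
  and its reflection `P U P` has `pfPlaquette = −c`.
* §4 **`not_spansGaugeInvariantCylinders_specialOrthogonalGroup_even`**: for every even `N ≥ 2` and every `d ≥ 2`,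
  `¬ SpansGaugeInvariantCylinders (d+2) (wilsonLoopProducts (specialOrthogonalRep (Fin N)) (d+2))`.

CONSEQUENCE FOR THE CELL'S QUESTION (honest scope).  Module XIX's route to `(3a) ⟺ (W-corr)` through the natural-
representation Wilson loops is CLOSED for `SO(2m)` (its density hypothesis is false), in contrast with `O(N)`, `SO(2m+1)`,
`U(N)`, `SU(N)`, `Sp(n)` (companion files).  Nothing is claimed about `(3a)` or `(W-corr)` themselves for `SO(2m)`, nor
about Wilson loops in OTHER representations (Lévy's Thm 3.1 with all representations is not formalised); NOT summit
progress.  Sources: [AslaksenTanZhu1995] = Aslaksen–Tan–Zhu, Pacific J. Math. 168 (1995) §1 p.207, Thm 3 p.209;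
[Levy2004] Abstract p.2 («If G is orthogonal, unitary or symplectic, then Wilson loops associated to the natural
representation of G are enough» — `SO(2m)` is not on that list); [Sengupta1994] Thm 2 p.900 («odd special orthogonal
groups SO(2n+1)»).  Cell context: lit-balaban (HOME `run/shared/lean/pub/lit-balaban/`), unit p24 gen 19, free-target
protocol G.5-34(d); the lattice form of pub-balaban `ir/SUFFICIENT.md` §25 (e)'s reading note; no SKELETON row.
-/

namespace Literature.MathematicalPhysics.QuantumFieldTheory.Balaban1983to89.WilsonLoopProductsNotDenseEvenOrthogonal

open Literature.MathematicalPhysics.QuantumLattice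
open Literature.Probability.LatticeModels (zdGraph)
open Balaban1983to89.Missing (SpansGaugeInvariantCylinders)
open TraceWordsSeparateOrbitsOrthogonal (specialOrthogonalRep specialOrthogonalRep_apply)
open TraceWordsSeparateOrbitsEvenOrthogonal (realJ negAt pfaffianSkew_conj pfaffianSkew_realJ_ne_zero star_negAt det_negAt
  negAt_mul_negAt negAt_mem_orthogonalGroup realJ_mem_specialOrthogonalGroup refl_mem_specialOrthogonalGroup realJ_transpose)
open Literature.LinearAlgebra.Matrix (pfaffian pfaffian_fin_add_two)
open scoped Matrix

noncomputable section

/-! ## §1 Conjugation by a reflection: an automorphism of `SO(2m)` invisible to the natural character -/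

section Reflection

variable (m : ℕ) (i₀ : Fin (m + m))

/-- `P g P ∈ SO(2m)` for `g ∈ SO(2m)` and the reflection `P = P_{i₀}` (`det = (−1)·1·(−1)`). [cite: AslaksenTanZhu1995, §1 p.207] -/
theorem negAt_conj_mem (g : Matrix.specialOrthogonalGroup (Fin (m + m)) ℝ) :
    negAt i₀ * (g : Matrix (Fin (m + m)) (Fin (m + m)) ℝ) * negAt i₀ ∈ Matrix.specialOrthogonalGroup (Fin (m + m)) ℝ := by
  obtain ⟨hgO, hgdet⟩ := Matrix.mem_specialUnitaryGroup_iff.mp g.2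
  refine Matrix.mem_specialUnitaryGroup_iff.mpr ⟨?_, ?_⟩
  · exact Submonoid.mul_mem _ (Submonoid.mul_mem _ (negAt_mem_orthogonalGroup i₀) hgO) (negAt_mem_orthogonalGroup i₀)
  · rw [Matrix.det_mul, Matrix.det_mul, det_negAt, hgdet]
    norm_num

/-- **`reflConj m i₀ : SO(2m) →* SO(2m)`, `g ↦ P g P`** — conjugation by the reflection `P = P_{i₀} ∈ O(2m) ∖ SO(2m)`
(`P = P⁻¹`), an automorphism of `SO(2m)` («when we restrict O(n, F) to SO(n, F)», [AslaksenTanZhu1995] §1).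
[cite: AslaksenTanZhu1995, §1 p.207] -/
def reflConj : Matrix.specialOrthogonalGroup (Fin (m + m)) ℝ →* Matrix.specialOrthogonalGroup (Fin (m + m)) ℝ where
  toFun g := ⟨negAt i₀ * (g : Matrix (Fin (m + m)) (Fin (m + m)) ℝ) * negAt i₀, negAt_conj_mem m i₀ g⟩
  map_one' := Subtype.ext (by
    change negAt i₀ * ((1 : Matrix.specialOrthogonalGroup (Fin (m + m)) ℝ) : Matrix (Fin (m + m)) (Fin (m + m)) ℝ) *
      negAt i₀ = ((1 : Matrix.specialOrthogonalGroup (Fin (m + m)) ℝ) : Matrix (Fin (m + m)) (Fin (m + m)) ℝ)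
    rw [Submonoid.coe_one, Matrix.mul_one, negAt_mul_negAt])
  map_mul' g h := Subtype.ext (by
    change negAt i₀ * ((g * h : Matrix.specialOrthogonalGroup (Fin (m + m)) ℝ) : Matrix (Fin (m + m)) (Fin (m + m)) ℝ) *
        negAt i₀ =
      negAt i₀ * (g : Matrix (Fin (m + m)) (Fin (m + m)) ℝ) * negAt i₀ *
        (negAt i₀ * (h : Matrix (Fin (m + m)) (Fin (m + m)) ℝ) * negAt i₀)
    rw [Submonoid.coe_mul]
    calc negAt i₀ * ((g : Matrix (Fin (m + m)) (Fin (m + m)) ℝ) * (h : Matrix (Fin (m + m)) (Fin (m + m)) ℝ)) * negAt i₀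
        = negAt i₀ * (g : Matrix (Fin (m + m)) (Fin (m + m)) ℝ) * (negAt i₀ * negAt i₀) *
            (h : Matrix (Fin (m + m)) (Fin (m + m)) ℝ) * negAt i₀ := by
          rw [negAt_mul_negAt, Matrix.mul_one]; simp only [Matrix.mul_assoc]
      _ = _ := by simp only [Matrix.mul_assoc])

/-- `reflConj m i₀ g = P g P` as a matrix. [cite: AslaksenTanZhu1995, §1 p.207] -/
@[simp] theorem coe_reflConj (g : Matrix.specialOrthogonalGroup (Fin (m + m)) ℝ) :
    ((reflConj m i₀ g : Matrix.specialOrthogonalGroup (Fin (m + m)) ℝ) : Matrix (Fin (m + m)) (Fin (m + m)) ℝ) =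
      negAt i₀ * (g : Matrix (Fin (m + m)) (Fin (m + m)) ℝ) * negAt i₀ := rfl

/-- The natural-representation character is blind to the reflection: `tr(P g P) = tr g` (`P² = 1`, cyclicity).
[cite: AslaksenTanZhu1995, §1 p.207] -/
theorem trace_reflConj (g : Matrix.specialOrthogonalGroup (Fin (m + m)) ℝ) :
    (specialOrthogonalRep (Fin (m + m)) (reflConj m i₀ g)).trace = (specialOrthogonalRep (Fin (m + m)) g).trace := by
  rw [specialOrthogonalRep_apply, specialOrthogonalRep_apply, coe_reflConj]
  change (Complex.ofRealHom.mapMatrix (negAt i₀ * (g : Matrix (Fin (m + m)) (Fin (m + m)) ℝ) * negAt i₀)).trace =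
    (Complex.ofRealHom.mapMatrix (g : Matrix (Fin (m + m)) (Fin (m + m)) ℝ)).trace
  rw [map_mul, map_mul, Matrix.trace_mul_cycle, ← map_mul, negAt_mul_negAt, map_one, Matrix.one_mul]

/-- Hence `Re`/`Im tr ρ(P g P) = Re/Im tr ρ(g)` for the natural representation `ρ`. [cite: AslaksenTanZhu1995, §1 p.207] -/
theorem tracePart_reflConj (b : Bool) (g : Matrix.specialOrthogonalGroup (Fin (m + m)) ℝ) :
    tracePart (specialOrthogonalRep (Fin (m + m))) b (reflConj m i₀ g) = tracePart (specialOrthogonalRep (Fin (m + m))) b g := by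
  cases b <;> simp only [tracePart, trace_reflConj]

end Reflection

/-! ## §2 Holonomies of a pointwise-transformed configuration; the Wilson loops are blind to the reflection -/

section Holonomy

variable {d : ℕ} {G H : Type*} [Group G] [Group H] (φ : G →* H) (U : LGConfig d G)

/-- Dart holonomies of `φ ∘ U` are `φ` of the dart holonomies. [folklore] -/
private theorem dartHolonomy_monoidHom (e : (zdGraph d).Dart) :
    dartHolonomy (fun x => φ (U x)) e = φ (dartHolonomy U e) := by
  unfold dartHolonomy
  split <;> simp

/-- **Holonomies of a pointwise-transformed configuration**: for a group homomorphism `φ`, the holonomy of `φ ∘ U` along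
any lattice walk is `φ` of the holonomy of `U` (the holonomy is an ordered product of edge variables and their inverses,
[Levy2004] §2 «h_l(g)»). [cite: Levy2004, §2 p.4] -/
theorem walkHolonomy_monoidHom {x y : Fin d → ℤ} (w : (zdGraph d).Walk x y) :
    walkHolonomy (fun e => φ (U e)) w = φ (walkHolonomy U w) := by
  simp only [walkHolonomy, map_list_prod, List.map_map]
  exact congrArg List.prod (List.map_congr_left fun e _ => dartHolonomy_monoidHom φ U e)

/-- The plaquette holonomy of `φ ∘ U` is `φ` of the plaquette holonomy. [cite: Levy2004, §2 p.4] -/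
theorem plaquetteHolonomyZd_monoidHom (x : Fin d → ℤ) (i j : Fin d) :
    plaquetteHolonomyZd (fun e => φ (U e)) x i j = φ (plaquetteHolonomyZd U x i j) := by
  simp only [plaquetteHolonomyZd, map_mul, map_inv]

variable (m : ℕ) (i₀ : Fin (m + m))

/-- Every natural-representation Wilson-loop generator of `SO(2m)` takes the same value at `U` and at the reflected
configuration `P U P`. [cite: AslaksenTanZhu1995, §1 p.207] -/
theorem loopFactor_reflConj (p : (Σ x : (Fin d → ℤ), (zdGraph d).Walk x x) × Bool)
    (U : LGConfig d (Matrix.specialOrthogonalGroup (Fin (m + m)) ℝ)) :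
    loopFactor (specialOrthogonalRep (Fin (m + m))) p (fun e => reflConj m i₀ (U e)) =
      loopFactor (specialOrthogonalRep (Fin (m + m))) p U := by
  rcases p with ⟨ℓ, b⟩
  rw [loopFactor_eq_tracePart, loopFactor_eq_tracePart, walkHolonomy_monoidHom, tracePart_reflConj]

/-- … hence so does every element of the real span of the Wilson-loop PRODUCTS (Lévy's class in the natural
representation). [cite: AslaksenTanZhu1995, §1 p.207] -/
theorem mem_span_wilsonLoopProducts_reflConj {W : LGConfig d (Matrix.specialOrthogonalGroup (Fin (m + m)) ℝ) → ℝ}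
    (hW : W ∈ Submodule.span ℝ (wilsonLoopProducts (specialOrthogonalRep (Fin (m + m))) d))
    (U : LGConfig d (Matrix.specialOrthogonalGroup (Fin (m + m)) ℝ)) :
    W (fun e => reflConj m i₀ (U e)) = W U := by
  induction hW using Submodule.span_induction with
  | mem w hw =>
    obtain ⟨l, rfl⟩ := hw
    induction l with
    | nil => simp
    | cons p l ih => simp only [loopProduct_cons, loopFactor_reflConj, ih]
  | zero => rfl
  | add w₁ w₂ _ _ h₁ h₂ => simp [h₁, h₂]
  | smul c w _ h => simp [h]

end Holonomy

/-! ## §3 The observable `p̃f(U_p)` and the test configurations -/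

section Observable

variable (m d : ℕ)

/-- The Pfaffian is continuous (a polynomial in the entries; induction over the Laplace-type expansion). [folklore] -/
private theorem continuous_pfaffian : ∀ {n : ℕ}, Continuous fun A : Matrix (Fin n) (Fin n) ℝ => pfaffian A
  | 0 => continuous_const
  | 1 => continuous_const
  | n + 2 => by
      have ih : Continuous fun A : Matrix (Fin n) (Fin n) ℝ => pfaffian A := continuous_pfaffian
      simp only [pfaffian_fin_add_two]
      refine continuous_finsetSum _ fun j _ => ?_
      refine (continuous_const.mul (continuous_id.matrix_elem 0 j.succ)).mul ?_
      exact ih.comp (continuous_id.matrix_submatrix _ _)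

/-- **The test observable `pfPlaquette m d (U) = p̃f(U_p) = pf(U_p − U_pᵀ)`**, `U_p` the holonomy of the plaquette at the
origin in the `(0, 1)` plane of `ℤ^{d+2}` read in the natural representation of `SO(2m)` ([AslaksenTanZhu1995] §1: the
Pfaffian of the skewsymmetric projection, «clearly an SO(2k, F) invariant»). [cite: AslaksenTanZhu1995, §1 p.207] -/
def pfPlaquette (U : LGConfig (d + 2) (Matrix.specialOrthogonalGroup (Fin (m + m)) ℝ)) : ℝ :=
  pfaffian (((plaquetteHolonomyZd U 0 0 1 : Matrix.specialOrthogonalGroup (Fin (m + m)) ℝ) :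
      Matrix (Fin (m + m)) (Fin (m + m)) ℝ) -
    ((plaquetteHolonomyZd U 0 0 1 : Matrix.specialOrthogonalGroup (Fin (m + m)) ℝ) : Matrix (Fin (m + m)) (Fin (m + m)) ℝ)ᵀ)

/-- `p̃f` is invariant under `SO(2m)`-conjugation of its argument (`det = 1`). [cite: AslaksenTanZhu1995, §1 p.207] -/
theorem pfaffianSkew_specialOrthogonal_conj (g h : Matrix.specialOrthogonalGroup (Fin (m + m)) ℝ) :
    pfaffian (((g * h * g⁻¹ : Matrix.specialOrthogonalGroup (Fin (m + m)) ℝ) : Matrix (Fin (m + m)) (Fin (m + m)) ℝ) -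
        ((g * h * g⁻¹ : Matrix.specialOrthogonalGroup (Fin (m + m)) ℝ) : Matrix (Fin (m + m)) (Fin (m + m)) ℝ)ᵀ) =
      pfaffian ((h : Matrix (Fin (m + m)) (Fin (m + m)) ℝ) - (h : Matrix (Fin (m + m)) (Fin (m + m)) ℝ)ᵀ) := by
  have hgdet : (g : Matrix (Fin (m + m)) (Fin (m + m)) ℝ).det = 1 := (Matrix.mem_specialUnitaryGroup_iff.mp g.2).2
  rw [← Matrix.star_eq_inv, Submonoid.coe_mul, Submonoid.coe_mul, Matrix.specialUnitaryGroup.coe_star, pfaffianSkew_conj,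
    hgdet, one_mul]

/-- `pfPlaquette` is GAUGE INVARIANT (the plaquette holonomy is conjugated at the base point). [cite: AslaksenTanZhu1995, §1 p.207] -/
theorem isZdGaugeInvariant_pfPlaquette : IsZdGaugeInvariant (pfPlaquette m d) := by
  intro g U
  simp only [pfPlaquette, plaquetteHolonomyZd_gaugeTransformZd, pfaffianSkew_specialOrthogonal_conj]

/-- `pfPlaquette` is a CYLINDER on the four plaquette edges. [cite: AslaksenTanZhu1995, §1 p.207] -/
theorem isCylinder_pfPlaquette :
    IsCylinder (pfPlaquette m d) {((0 : Fin (d + 2) → ℤ), (0 : Fin (d + 2))), ((0 : Fin (d + 2) → ℤ) + Pi.single 0 1, 1),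
      ((0 : Fin (d + 2) → ℤ) + Pi.single 1 1, 0), ((0 : Fin (d + 2) → ℤ), 1)} := by
  intro U V h
  simp only [pfPlaquette, plaquetteHolonomyZd]
  rw [h _ (by simp), h ((0 : Fin (d + 2) → ℤ) + Pi.single 0 1, 1) (by simp),
    h ((0 : Fin (d + 2) → ℤ) + Pi.single 1 1, 0) (by simp), h ((0 : Fin (d + 2) → ℤ), 1) (by simp)]

/-- `pfPlaquette` is CONTINUOUS. [cite: AslaksenTanZhu1995, §1 p.207] -/
theorem continuous_pfPlaquette : Continuous (pfPlaquette m d) := by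
  have hhol : Continuous fun U : LGConfig (d + 2) (Matrix.specialOrthogonalGroup (Fin (m + m)) ℝ) =>
      plaquetteHolonomyZd U 0 0 1 := by
    unfold plaquetteHolonomyZd
    fun_prop
  have hval : Continuous fun U : LGConfig (d + 2) (Matrix.specialOrthogonalGroup (Fin (m + m)) ℝ) =>
      ((plaquetteHolonomyZd U 0 0 1 : Matrix.specialOrthogonalGroup (Fin (m + m)) ℝ) :
        Matrix (Fin (m + m)) (Fin (m + m)) ℝ) := continuous_subtype_val.comp hhol
  exact continuous_pfaffian.comp (hval.sub hval.matrix_transpose)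

/-- `pfPlaquette` is BOUNDED (a continuous function on the compact configuration space). [cite: AslaksenTanZhu1995, §1 p.207] -/
theorem exists_bound_pfPlaquette : ∃ C : ℝ, ∀ U, |pfPlaquette m d U| ≤ C := by
  obtain ⟨U₀, -, hU₀⟩ := isCompact_univ.exists_isMaxOn Set.univ_nonempty
    ((continuous_pfPlaquette m d).abs.continuousOn (s := Set.univ))
  exact ⟨|pfPlaquette m d U₀|, fun U => hU₀ (Set.mem_univ U)⟩

/-- `J ∈ SO(2m)` as a group element. [cite: AslaksenTanZhu1995, §1 p.208] -/
def elemJ : Matrix.specialOrthogonalGroup (Fin (m + m)) ℝ := ⟨realJ m, realJ_mem_specialOrthogonalGroup m⟩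

/-- The TEST CONFIGURATION: `J` on the edge `(0, 0)`, `1` elsewhere (module XX's `testConfig` pattern).
[cite: AslaksenTanZhu1995, §1 p.207] -/
def testConfigJ : LGConfig (d + 2) (Matrix.specialOrthogonalGroup (Fin (m + m)) ℝ) := fun e =>
  if e = ((0 : Fin (d + 2) → ℤ), (0 : Fin (d + 2))) then elemJ m else 1

/-- The plaquette holonomy of the test configuration is `J`. [cite: AslaksenTanZhu1995, §1 p.207] -/
theorem plaquetteHolonomyZd_testConfigJ : plaquetteHolonomyZd (testConfigJ m d) 0 0 1 = elemJ m := by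
  have h1 : testConfigJ m d ((0 : Fin (d + 2) → ℤ), 0) = elemJ m := by simp [testConfigJ]
  have h2 : testConfigJ m d ((0 : Fin (d + 2) → ℤ) + Pi.single 0 1, 1) = 1 := by simp [testConfigJ]
  have h3 : testConfigJ m d ((0 : Fin (d + 2) → ℤ) + Pi.single 1 1, 0) = 1 := by simp [testConfigJ]
  have h4 : testConfigJ m d ((0 : Fin (d + 2) → ℤ), 1) = 1 := by simp [testConfigJ]
  rw [plaquetteHolonomyZd, h1, h2, h3, h4, inv_one, mul_one, mul_one, mul_one]

/-- `pfPlaquette (testConfigJ) = c := p̃f(J)`. [cite: AslaksenTanZhu1995, §1 p.207] -/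
theorem pfPlaquette_testConfigJ : pfPlaquette m d (testConfigJ m d) = pfaffian (realJ m - (realJ m)ᵀ) := by
  rw [pfPlaquette, plaquetteHolonomyZd_testConfigJ]
  rfl

/-- `pfPlaquette` of the REFLECTED test configuration `P U P` is `−c` (`p̃f(P J P) = det P · p̃f(J)`).
[cite: AslaksenTanZhu1995, §1 p.207] -/
theorem pfPlaquette_reflConj_testConfigJ (i₀ : Fin (m + m)) :
    pfPlaquette m d (fun e => reflConj m i₀ (testConfigJ m d e)) = -pfaffian (realJ m - (realJ m)ᵀ) := by
  rw [pfPlaquette, plaquetteHolonomyZd_monoidHom, plaquetteHolonomyZd_testConfigJ, coe_reflConj]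
  change pfaffian (negAt i₀ * realJ m * negAt i₀ - (negAt i₀ * realJ m * negAt i₀)ᵀ) = -pfaffian (realJ m - (realJ m)ᵀ)
  conv_lhs => rw [← star_negAt i₀, star_negAt i₀,
    show negAt i₀ * realJ m * negAt i₀ = negAt i₀ * realJ m * star (negAt i₀) by rw [star_negAt]]
  rw [pfaffianSkew_conj, det_negAt]
  ring

end Observable

/-! ## §4 The negative -/

section Negative

variable {d : ℕ}

/-- **CENSUS NEGATIVE — `SO(2m)`, `m ≥ 1`, every `d ≥ 2`: LÉVY-TYPE DENSITY FAILS ON `ℤ^d` FOR THE NATURAL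
REPRESENTATION**, `¬ SpansGaugeInvariantCylinders (d+2) (wilsonLoopProducts (specialOrthogonalRep (Fin (m+m))) (d+2))`.
Every element `W` of the span of the Wilson-loop products satisfies `W(P U P) = W(U)`
(`mem_span_wilsonLoopProducts_reflConj`), while the gauge-invariant continuous bounded cylinder `p̃f(U_p)` takes the values
`c ≠ 0` at the test configuration and `−c` at its reflection — so it is not within `|c|/2` of the span.  (Module XX's
`not_spansGaugeInvariantCylinders_so2Rep` is the case `SO(2) ≅ U(1)` in another presentation; [Levy2004]'s Abstract lists
«orthogonal, unitary or symplectic» `G` for the natural representation, [Sengupta1994] Thm 2 the «odd special orthogonal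
groups» — `SO(2m)` is on neither list, and [AslaksenTanZhu1995] Thm 3 says what is missing: the polarized Pfaffians.)
[cite: AslaksenTanZhu1995, §1 p.207 and Thm 3 p.209] -/
theorem not_spansGaugeInvariantCylinders_specialOrthogonalGroup_add_self (m : ℕ) (hm : 1 ≤ m) :
    ¬ SpansGaugeInvariantCylinders (d + 2) (wilsonLoopProducts (specialOrthogonalRep (Fin (m + m))) (d + 2)) := by
  intro h
  let i₀ : Fin (m + m) := ⟨0, by omega⟩
  set c : ℝ := pfaffian (realJ m - (realJ m)ᵀ) with hcdef
  have hc : c ≠ 0 := pfaffianSkew_realJ_ne_zero m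
  obtain ⟨W, hW, hclose⟩ := h (pfPlaquette m d) _ (isCylinder_pfPlaquette m d) (continuous_pfPlaquette m d)
    (exists_bound_pfPlaquette m d) (isZdGaugeInvariant_pfPlaquette m d) (|c| / 2) (by positivity)
  have h1 := hclose (testConfigJ m d)
  have h2 := hclose (fun e => reflConj m i₀ (testConfigJ m d e))
  rw [pfPlaquette_testConfigJ] at h1
  rw [pfPlaquette_reflConj_testConfigJ, mem_span_wilsonLoopProducts_reflConj m i₀ hW] at h2
  have h3 : |c - (-c)| ≤ |c| / 2 + |c| / 2 := by
    calc |c - (-c)| = |(c - W (testConfigJ m d)) - (-c - W (testConfigJ m d))| := by ring_nf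
      _ ≤ |c - W (testConfigJ m d)| + |(-c) - W (testConfigJ m d)| := abs_sub _ _
      _ ≤ |c| / 2 + |c| / 2 := add_le_add h1 h2
  have h4 : |c - (-c)| = 2 * |c| := by
    rw [sub_neg_eq_add, ← two_mul, abs_mul, abs_two]
  have h5 : |c| ≤ 0 := by linarith
  exact hc (abs_eq_zero.mp (le_antisymm h5 (abs_nonneg c)))

/-- **`SO(N)`, `N` EVEN, `N ≥ 2`, every `d ≥ 2`:
`¬ SpansGaugeInvariantCylinders (d+2) (wilsonLoopProducts (specialOrthogonalRep (Fin N)) (d+2))`** — module XIX's density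
hypothesis is FALSE for the natural representation of every even special orthogonal group, so its route to `(3a) ⟺ (W-corr)`
does not apply to `SO(2m)` lattice gauge theory through these Wilson loops. [cite: AslaksenTanZhu1995, Thm 3 p.209] -/
theorem not_spansGaugeInvariantCylinders_specialOrthogonalGroup_even {N : ℕ} (hN : Even N) (h2 : 2 ≤ N) :
    ¬ SpansGaugeInvariantCylinders (d + 2) (wilsonLoopProducts (specialOrthogonalRep (Fin N)) (d + 2)) := by
  obtain ⟨m, rfl⟩ := hN
  exact not_spansGaugeInvariantCylinders_specialOrthogonalGroup_add_self m (by omega)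

end Negative

end

end Literature.MathematicalPhysics.QuantumFieldTheory.Balaban1983to89.WilsonLoopProductsNotDenseEvenOrthogonal
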